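/-
Copyright (c) 2026 the pub-hodgecm-mathlib formalisation cell (harness21).  Prover seat hodgecm-mathlib-LH4-p15 (g3), req620 Track A «(D-RAM) FOUR-FRAME» squad
((β₂) road (R-36), the K6 road — K6 DESK WORDS #25∕#26 (γ) «A5-D0 COMPOSER»: the δ = 0 corner of `core_holds`' top hole `htop`, i.e. «X_H(b,b) = X_A(b,b)», composed from
the two δ = 0 cell laws ((α), LH4-p12 (g10)) and the δ = 0 density ((β) = ★ `topCell_density` at `N := 0`, LH4-p08 (g12)) taken as LETTERS, with ★ §3, ★ (d′1), and
★ p864688 §1 for ★ (g-top) — the `N = 0` twin of ★ A5 p865015 `topCell_identity`), 2026-09-05.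
-/
import Summits.HodgeConjecture.HodgeConjecture.Theorems.F0P3cDyRamCoreOfPerCellLaws             -- ★ p864409∕p864591 (LH4-p16 (g3)) §3 `cellValue_of_perCellLaw` (law + density ⟹ solved value); brings the letters' vocabulary
import Summits.HodgeConjecture.HodgeConjecture.Theorems.F0P3cDyRamRowCellDigitClassSplit        -- ★ (d′1) (LH7-p08 (g3)): `classClause_iff_not_classClause`, `classClause_or`
import Summits.HodgeConjecture.HodgeConjecture.Theorems.F0P3cDyRamRowCellDigitShellDictionary   -- ★ p864361 (LH7-p08 (g3)): `sphereClause_of_radius_one` (at radius one the sphere clause is automatic)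
import Summits.HodgeConjecture.HodgeConjecture.Theorems.F0P3cDyRamTopSphereLabelSumVanishes     -- ★ p864688 (LH4-p08 (g12)) §1 `sum_normSign_affine_filterUnit_eq_zero` (all unit-label digits: `Σ ω = 0`)
import Summits.HodgeConjecture.HodgeConjecture.Theorems.F0P3cDyRamBeta2ConesBOfRows            -- ★ p862801: brings every token of the cone-row currency (`levelSetDep`, `IsSelfDualLattice`, `LatticeNearTransvShell`, `valueSetMod`, `xPlus`, `endoGL`, …)
import HarnessLib

/-!
# Crux `H413`, line LH4 «(D-RAM) FOUR-FRAME» — (β₂) road, the K6 road, (γ) «A5-D0 COMPOSER»: «THE GAP-ZERO TOP CELL IDENTITY» — at the δ = 0 corner (`jl = m`, the top cell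
# IS the diagonal cell `(b, b)`) of ‹CORE.letter.v1› ∕ ‹CORE-ODD.v1›: `X_H(b) = if 0 < d then X_A(b) else 0` (★ (P1)'s `htop` bytes at `N := 0`, `j := b`), from the two
# δ = 0 cell LAWS and the δ = 0 DENSITY taken as letters (hypothesis-first; (α) LH4-p12 (g10) and (β) = ★ `topCell_density (N := 0)` plug them in A6)

Cell `hodgecm-mathlib` (D-0151), FLOOR 0, crux item H413 = `stmt-HodgeConjecture-24833`, route of record `HCCMUnconditional`; squad F0∕P3c∕LH4; lane
`--supports stmt-HodgeConjecture-24833 --as helper` (count-neutral; pays NO tier-0 row).  THEOREMS ONLY (no `def`, no instance, no notation, no `sorry`, default heartbeats);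
★-only imports; states NO law; ‹CORE›∕‹CORE-ODD›∕‹D0›∕(β₂) stay HYPOTHESES of their consumers.

WHAT (K6 DESK WORD #25 «the δ = 0 corner ‹D0› is inside `core_holds`∕`coreOdd_holds`»; WORD #26 (4) «(γ) RE-DEALT → LH4-p15»).  At window `N = 0` ★ (P1)
`coreWindow_of_insideWindow_and_topCell`'s `hin` is an empty sum and its `htop` reads `X_H(b) = if 0 < d then X_A(b) else 0` — the PARKED ‹D0› «X_H(b,b) = X_A(b,b)» at every `d`
and both parities (LH4-p06 (g9) MECH-D0.v1 §4).  ★ A5 p865015 `topCell_identity` pays `htop` for `N ≥ 1` only (★ F1b-top reads `b < j`); THIS FILE is its `N = 0` twin, with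
the two gap-zero CELL LAWS taken as LETTERS in ★ F1b-top's output bytes at `j := b` (`hlawH`, `hlawA` — (α) `…RowDiagCellGapZeroPerCellValue.rowDiag_cellDiff_mul_card_eq_gapZero`
×2, LH4-p12 (g10), plugs them; WORD #26 (3): at δ = 0 the `NX` lambda `|μ_a + μ_b(R₀ + Vγ₀)| = |ϖ|^{2b+d%2}` keeps its BYTES and MEANS «non-X digit»), the DENSITY as letters
(`hdensH`, `hdensA` at one `φ` — ★ `topCell_density (N := 0)` p864904, LH4-p08 (g12)), and the gap-zero chart∕label letters of (δ) `A1-D0.interface.v1` 1285ddfe (LH4-p16 (g3)):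
`|κ₀| = 1`, `|ξ₀| = 1`, `|α₁| ≤ 1`, `|γ₁| = 1`, the unit letter `hαγ` AND its converse `hγα`.  MECHANISM (★ only): ★ §3 `cellValue_of_perCellLaw` ×2 (`X_t = φ·ω(−h_W^t)·Σ_{S′_t} ω`);
the SIGN `ω(−η) = −ω(−1)` (★ Lit `normSign_mul_eq_neg_of_not_norm`, `η ∉ N`); on the digit line the sphere clause at radius ONE is AUTOMATIC (★ `sphereClause_of_radius_one`:
`|κ₀| = 1`, `|ξ₀| ≤ 1`), `NX V ↔ |α₁ + γ₁V| = 1` (`hαγ`∕`hγα`), and the classes split the digit line (★ (d′1) `classClause_or`, `classClause_iff_not_classClause`; `0 < d` always, no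
far branch); so `Σ_{S′_H} ω + Σ_{S′_A} ω = Σ_{V ∈ Rd, |α₁ + γ₁V| = 1} ω(α₁ + γ₁V) = 0` by ★ p864688 §1 `sum_normSign_affine_filterUnit_eq_zero` (`|α₁| ≤ 1`, `|γ₁| = 1`, `2d − 1 ≤ n` —
★ D0-4 p864478's sum in the top-sphere file's currency); `linear_combination`.
BINDERS (all BY NAME from ‹CORE.v1› ∕ (δ) ∕ (α) ∕ (β)): the sheet `hD h2`, `jE ρ Θ α lam` with `hρρ hvρ hΘρ hjfix hΘj hjiso hU`, the frame equation `P₁ dg η hA hηN hησ` and the two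
line models `φ h hform hΘh hh`, `φ' h' hform' hΘh' hh'` (for ★ (d′1)), the cell objects `u γ₂ γA f f' hfinLS hfinLS' b`, the gap-zero chart `{κ₀ ξ₀} hκ₀ hΘκ₀ hκ₀v hξ hΘξ hξ1 {μa μb R₀ γ₀}
{α₁ γ₁} hα₁σ hα₁1 hγ₁σ hγ₁v hαγ hγα`, the digit system `Rd {n} hn hRd1 hRd2 hRd3`, the LAW letters `hlawH hlawA`, the DENSITY letters `{φd} hdensH hdensA`.
WHAT IS NOT CLAIMED: the laws (α), the density (β), the chart (δ), any size, any census identity; the `N ≥ 1` windows (★ A5).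
HONEST LABEL.  Count-neutral composition of ★ pieces and named letters; nothing printed is asserted; no census law is stated; `HC_CM` is proved only modulo the 7 printed citations
(2 remaining named inputs: hLiu418 = `stmt-HodgeConjecture-24832`, h413 = `stmt-HodgeConjecture-24833`) until rung 0 closes.
## References
* [Kottwitz1986BaseChangeUnits] R. E. Kottwitz, *Base change for unit elements of Hecke algebras*, Compositio Math. 60 (1986): §1 pp. 240–241 (signed lattice counts cell by cell).
* [LabesseLanglands1979] J.-P. Labesse, R. P. Langlands, *L-indistinguishability for SL(2)*, Canad. J. Math. 31 (1979): §2 (2.2) p. 9 (κ-signed counts).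
* [Rogawski1990] J. D. Rogawski, *Automorphic Representations of Unitary Groups in Three Variables*, Ann. of Math. Stud. 123 (1990): §4.9 Prop. 4.9.1 (b) p. 55.
* [Serre1979] J.-P. Serre, *Local Fields*, GTM 67 (1979): Ch. V §3 Prop. 5, Cor. 2–3 pp. 84–86; Ch. XV §2 (the conductor of the norm-residue sign); [Jacobowitz1962] §3.
-/

set_option autoImplicit false

noncomputable section

namespace Summit.HodgeConjecture.HodgeConjecture.Cruxes.H413.F0P3cDyRamDiagCellGapZeroIdentity

open scoped Valued WithZero Matrix MatrixGroups Classical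
open WithZero Finset
open Literature.NumberTheory.Automorphic Literature.NumberTheory.Automorphic.HermitianLattice Literature.NumberTheory.Automorphic.UnitaryLatticeTree
open Literature.NumberTheory.Automorphic.UnitaryThreeFourFrame (IsRamifiedQuadraticDatum normSign)
open Literature.NumberTheory.LocalFields.WildQuadraticDatum (normSign_mul_eq_neg_of_not_norm)
open Literature.NumberTheory.Rogawski1990
open Summit.HodgeConjecture.HodgeConjecture.Cruxes.H413.F0P3cDyRamFourFramePieces
open Summit.HodgeConjecture.HodgeConjecture.Cruxes.H413.F0P3cDyRamFourFrameCensusDefs (LatticeInLevel LatticeNearTransvShell)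
open Summit.HodgeConjecture.HodgeConjecture.Cruxes.H413.F0P3cDyRamStageOneBDefs (mcOfRecord)
open Summit.HodgeConjecture.HodgeConjecture.Cruxes.H413.F0P3cDyRamToricCensusDefs
open Summit.HodgeConjecture.HodgeConjecture.Cruxes.H413.F0P3cDyRamCoreOfPerCellLaws (cellValue_of_perCellLaw)
open Summit.HodgeConjecture.HodgeConjecture.Cruxes.H413.F0P3cDyRamRowCellDigitClassSplit (classClause_iff_not_classClause classClause_or)
open Summit.HodgeConjecture.HodgeConjecture.Cruxes.H413.F0P3cDyRamRowCellDigitShellDictionary (sphereClause_of_radius_one)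
open Summit.HodgeConjecture.HodgeConjecture.Cruxes.H413.F0P3cDyRamTopSphereLabelSumVanishes (sum_normSign_affine_filterUnit_eq_zero)

variable {E M : Type} [Field E] [Valued E ℤᵐ⁰] [Field M] [Valued M ℤᵐ⁰]

/-- **HEAD — «THE GAP-ZERO TOP CELL IDENTITY FROM ITS LAWS» ((γ) «A5-D0 COMPOSER», K6 DESK WORDS #25∕#26; the `N = 0` twin of ★ A5 `topCell_identity`).**  Letters BY NAME: the sheet
`hD`, `h2`; `jE ρ Θ α lam` with `hρρ hvρ hΘρ hjfix hΘj hjiso hU`; the frame equation `hA` with `η ∉ N` (`hηN`, `hησ`) and the two line models `(φ, h)`, `(φ′, h′)` (★ (d′1)'s frame);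
the cell objects `u γ₂ γA f f′ hfinLS hfinLS′ b`; the gap-zero chart ((δ)'s conjuncts: `hκ₀ hΘκ₀ hκ₀v hξ hΘξ (hξ1 : |ξ₀| = 1)`, `μa μb R₀ γ₀`, `hα₁σ (hα₁1 : |α₁| ≤ 1) hγ₁σ (hγ₁v : |γ₁| = 1)
hαγ hγα`); a digit system `Rd` mod `|ϖ|^n`, `2d − 1 ≤ n`; the two gap-zero CELL LAWS `hlawH`, `hlawA` (★ F1b-top's output bytes at `j := b`, `NX` lambda unchanged — (α)'s conclusions)
and the DENSITY letters `hdensH`, `hdensA` (one `φ`; (β) = ★ `topCell_density (N := 0)`).  THEN `X_H(b) = if 0 < d then X_A(b) else 0` — ★ (P1)'s `htop` at `N := 0`, `j := b`,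
`ϖE := jE ϖ`, `μ := lam − jE u₀₀`, the letters' set-builders. [cite: Kottwitz1986BaseChangeUnits, §1 pp. 240–241] [cite: LabesseLanglands1979, §2 (2.2) p. 9]
[cite: Rogawski1990, §4.9 Prop. 4.9.1 (b) p. 55] [cite: Serre1979, Ch. V §3 Cor. 3; Ch. XV §2] -/
theorem diagCell_gapZero_identity_of_laws [CompleteSpace E] [Finite 𝓀[E]]
    (σ : E →+* E) (ϖ : E) (d tE : ℕ) (hD : IsRamifiedQuadraticDatum σ ϖ d tE) (h2 : ¬ IsUnit (2 : 𝒪[E]))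
    (jE : E →+* M) (ρ Θ : M →+* M) (α lam : M)
    (hρρ : ∀ z, ρ (ρ z) = z) (hvρ : ∀ z, Valued.v (ρ z) = Valued.v z) (hΘρ : ∀ z, Θ (ρ z) = ρ (Θ z))
    (hjfix : ∀ z : M, ρ z = z ↔ ∃ a, jE a = z) (hΘj : ∀ a, Θ (jE a) = jE (σ a)) (hjiso : ∀ a, Valued.v (jE a) = Valued.v a)
    (hU : Valued.v (α - ρ α) = 1)
    (u : GL (Fin 1) E)
    -- the hyperbolic literal's cell objects
    (γ₂ : GL (Fin 2) E) (φ : (Fin 2 → E) →+ M) (h : M)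
    (hform : ∀ x y, jE (pairing σ ((StdForm.antidiagonal 2).over E) x y) = h * Θ (φ x) * φ y + ρ (h * Θ (φ x) * φ y)) (hΘh : Θ h = h) (hh : h ≠ 0)
    (f : ℕ → ℕ → AddSubgroup M → ℕ) (hfinLS : ∀ j a, (levelSet ρ Θ α (jE ϖ) h j a).Finite)
    -- the anisotropic literal's frame and cell objects
    (P₁ : GL (Fin 3) E) (dg : Fin 2 → E) (η : E) (γA : GL (Fin 2) E)
    (hA : formCongr σ P₁ ((StdForm.antidiagonal 3).over E) =
      (!![(Matrix.diagonal dg) 0 0, 0, (Matrix.diagonal dg) 0 1; 0, η, 0; (Matrix.diagonal dg) 1 0, 0, (Matrix.diagonal dg) 1 1] : Matrix (Fin 3) (Fin 3) E))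
    (hησ : σ η = η) (hηN : ¬ ∃ t : E, t * σ t = η)
    (φ' : (Fin 2 → E) →+ M) (h' : M)
    (hform' : ∀ x y, jE (pairing σ (Matrix.diagonal dg) x y) = h' * Θ (φ' x) * φ' y + ρ (h' * Θ (φ' x) * φ' y)) (hΘh' : Θ h' = h') (hh' : h' ≠ 0)
    (f' : ℕ → ℕ → AddSubgroup M → ℕ) (hfinLS' : ∀ j a, (levelSet ρ Θ α (jE ϖ) h' j a).Finite)
    -- the row's half `b` (`2b + d%2 = m = jl`: the top cell IS the diagonal cell)
    (b : ℕ)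
    -- the gap-zero chart ((δ) `A1-D0.interface.v1`'s letters)
    {κ₀ ξ₀ : M} (hκ₀ : κ₀ + ρ κ₀ = 1) (hΘκ₀ : Θ κ₀ = κ₀) (hκ₀v : Valued.v κ₀ = 1) (hξ : ρ ξ₀ = -ξ₀) (hΘξ : Θ ξ₀ = ξ₀) (hξ1 : Valued.v ξ₀ = 1)
    {μa μb R₀ γ₀ : E}
    {α₁ γ₁ : E} (hα₁σ : σ α₁ = α₁) (hα₁1 : Valued.v α₁ ≤ 1) (hγ₁σ : σ γ₁ = γ₁) (hγ₁v : Valued.v γ₁ = 1)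
    (hαγ : ∀ V : E, σ V = V → Valued.v V ≤ 1 → Valued.v (μa + μb * (R₀ + V * γ₀)) = Valued.v ϖ ^ (2 * b + d % 2) → Valued.v (α₁ + γ₁ * V) = 1)
    (hγα : ∀ V : E, σ V = V → Valued.v V ≤ 1 → Valued.v (α₁ + γ₁ * V) = 1 → Valued.v (μa + μb * (R₀ + V * γ₀)) = Valued.v ϖ ^ (2 * b + d % 2))
    -- the digit system, `2d − 1 ≤ n`
    (Rd : Finset E) {n : ℕ} (hn : 2 * d - 1 ≤ n) (hRd1 : ∀ V ∈ Rd, σ V = V ∧ Valued.v V ≤ 1)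
    (hRd2 : ∀ V : E, σ V = V → Valued.v V ≤ 1 → ∃ V₀ ∈ Rd, Valued.v (V - V₀) ≤ Valued.v ϖ ^ n)
    (hRd3 : ∀ V ∈ Rd, ∀ V' ∈ Rd, Valued.v (V - V') ≤ Valued.v ϖ ^ n → V = V')
    -- the two gap-zero CELL LAWS ((α) ×2, ★ F1b-top's output bytes at `j := b`)
    (hlawH : (((∑ᶠ Λ ∈ levelSetDep ρ Θ α (jE ϖ) h b b (lam - jE ((u : Matrix (Fin 1) (Fin 1) E) 0 0)) ∩
          {Λ | ∃ B : Submodule 𝒪[E] (Fin 2 → E), B.toAddSubgroup.map φ = Λ ∧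
            ∃ L₃ : Submodule 𝒪[E] (Fin 3 → E), IsSelfDualLattice σ ϖ (!![((StdForm.antidiagonal 2).over E) 0 0, 0, ((StdForm.antidiagonal 2).over E) 0 1; 0, (1 : E), 0; ((StdForm.antidiagonal 2).over E) 1 0, 0, ((StdForm.antidiagonal 2).over E) 1 1] : Matrix (Fin 3) (Fin 3) E) L₃ ∧
              L₃ ⊓ LinearMap.ker ((LinearMap.proj (1 : Fin 3) : (Fin 3 → E) →ₗ[E] E).restrictScalars 𝒪[E]) =
                B.map ((Matrix.toLin' (!![1, 0; 0, 0; 0, 1] : Matrix (Fin 3) (Fin 2) E)).restrictScalars 𝒪[E]) ∧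
              (∀ c : E, (Pi.single 1 c : Fin 3 → E) ∈ L₃ ↔ Valued.v c ≤ Valued.v ϖ ^ b) ∧
              (LatticeNearTransvShell ϖ (d % 2) (mstarOfRecord d) ((((endoGL (γ₂, u) : GL (Fin 3) E) : Matrix (Fin 3) (Fin 3) E) - 1)) L₃ ∧
                {z : E | ∃ y ∈ L₃, Valued.v ((ϖ ^ (mstarOfRecord d))⁻¹ * (z - pairing σ (!![((StdForm.antidiagonal 2).over E) 0 0, 0, ((StdForm.antidiagonal 2).over E) 0 1; 0, (1 : E), 0; ((StdForm.antidiagonal 2).over E) 1 0, 0, ((StdForm.antidiagonal 2).over E) 1 1] : Matrix (Fin 3) (Fin 3) E) y (((((endoGL (γ₂, u) : GL (Fin 3) E) : Matrix (Fin 3) (Fin 3) E) - 1)) *ᵥ y))) ≤ 1} =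
                  valueSetMod σ ϖ (mstarOfRecord d) (xPlus σ ϖ d))}, f b b Λ : ℕ) : ℤ) -
        ((∑ᶠ Λ ∈ levelSetDep ρ Θ α (jE ϖ) h b b (lam - jE ((u : Matrix (Fin 1) (Fin 1) E) 0 0)) ∩
          {Λ | ∃ B : Submodule 𝒪[E] (Fin 2 → E), B.toAddSubgroup.map φ = Λ ∧
            ∃ L₃ : Submodule 𝒪[E] (Fin 3 → E), IsSelfDualLattice σ ϖ (!![((StdForm.antidiagonal 2).over E) 0 0, 0, ((StdForm.antidiagonal 2).over E) 0 1; 0, (1 : E), 0; ((StdForm.antidiagonal 2).over E) 1 0, 0, ((StdForm.antidiagonal 2).over E) 1 1] : Matrix (Fin 3) (Fin 3) E) L₃ ∧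
              L₃ ⊓ LinearMap.ker ((LinearMap.proj (1 : Fin 3) : (Fin 3 → E) →ₗ[E] E).restrictScalars 𝒪[E]) =
                B.map ((Matrix.toLin' (!![1, 0; 0, 0; 0, 1] : Matrix (Fin 3) (Fin 2) E)).restrictScalars 𝒪[E]) ∧
              (∀ c : E, (Pi.single 1 c : Fin 3 → E) ∈ L₃ ↔ Valued.v c ≤ Valued.v ϖ ^ b) ∧
              (LatticeNearTransvShell ϖ (d % 2) (mcOfRecord d) ((((endoGL (γ₂, u) : GL (Fin 3) E) : Matrix (Fin 3) (Fin 3) E) - 1)) L₃ ∧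
                ¬ {z : E | ∃ y ∈ L₃, Valued.v ((ϖ ^ (mstarOfRecord d))⁻¹ * (z - pairing σ (!![((StdForm.antidiagonal 2).over E) 0 0, 0, ((StdForm.antidiagonal 2).over E) 0 1; 0, (1 : E), 0; ((StdForm.antidiagonal 2).over E) 1 0, 0, ((StdForm.antidiagonal 2).over E) 1 1] : Matrix (Fin 3) (Fin 3) E) y (((((endoGL (γ₂, u) : GL (Fin 3) E) : Matrix (Fin 3) (Fin 3) E) - 1)) *ᵥ y))) ≤ 1} =
                  valueSetMod σ ϖ (mstarOfRecord d) (xPlus σ ϖ d))}, f b b Λ : ℕ) : ℤ)) *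
        ((Rd.filter (fun V₀ : E => Valued.v (κ₀ + jE V₀ * ξ₀) * Valued.v (jE ϖ ^ b * (α - ρ α)) = Valued.v (jE ϖ) ^ b ∧
        ∃ e : M, ρ e = e ∧ e * Θ e = (κ₀ + jE V₀ * ξ₀) * ρ (κ₀ + jE V₀ * ξ₀) / (h * ρ h))).card : ℤ) =
      ((∑ᶠ Λ ∈ levelSetDep ρ Θ α (jE ϖ) h b b (lam - jE ((u : Matrix (Fin 1) (Fin 1) E) 0 0)), f b b Λ : ℕ) : ℤ) *
        (normSign σ (-(1 : E)) * ∑ V ∈ (Rd.filter (fun V₀ : E => Valued.v (κ₀ + jE V₀ * ξ₀) * Valued.v (jE ϖ ^ b * (α - ρ α)) = Valued.v (jE ϖ) ^ b ∧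
        ∃ e : M, ρ e = e ∧ e * Θ e = (κ₀ + jE V₀ * ξ₀) * ρ (κ₀ + jE V₀ * ξ₀) / (h * ρ h))).filter
          (fun V => Valued.v (μa + μb * (R₀ + V * γ₀)) = Valued.v ϖ ^ (2 * b + d % 2)), normSign σ (α₁ + γ₁ * V)))
    (hlawA : (((∑ᶠ Λ ∈ levelSetDep ρ Θ α (jE ϖ) h' b b (lam - jE ((u : Matrix (Fin 1) (Fin 1) E) 0 0)) ∩
          {Λ | ∃ B : Submodule 𝒪[E] (Fin 2 → E), B.toAddSubgroup.map φ' = Λ ∧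
            ∃ L₃ : Submodule 𝒪[E] (Fin 3 → E), IsSelfDualLattice σ ϖ (!![(Matrix.diagonal dg) 0 0, 0, (Matrix.diagonal dg) 0 1; 0, η, 0; (Matrix.diagonal dg) 1 0, 0, (Matrix.diagonal dg) 1 1] : Matrix (Fin 3) (Fin 3) E) L₃ ∧
              L₃ ⊓ LinearMap.ker ((LinearMap.proj (1 : Fin 3) : (Fin 3 → E) →ₗ[E] E).restrictScalars 𝒪[E]) =
                B.map ((Matrix.toLin' (!![1, 0; 0, 0; 0, 1] : Matrix (Fin 3) (Fin 2) E)).restrictScalars 𝒪[E]) ∧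
              (∀ c : E, (Pi.single 1 c : Fin 3 → E) ∈ L₃ ↔ Valued.v c ≤ Valued.v ϖ ^ b) ∧
              (LatticeNearTransvShell ϖ (d % 2) (mstarOfRecord d) ((((endoGL (γA, u) : GL (Fin 3) E) : Matrix (Fin 3) (Fin 3) E) - 1)) L₃ ∧
                {z : E | ∃ y ∈ L₃, Valued.v ((ϖ ^ (mstarOfRecord d))⁻¹ * (z - pairing σ (!![(Matrix.diagonal dg) 0 0, 0, (Matrix.diagonal dg) 0 1; 0, η, 0; (Matrix.diagonal dg) 1 0, 0, (Matrix.diagonal dg) 1 1] : Matrix (Fin 3) (Fin 3) E) y (((((endoGL (γA, u) : GL (Fin 3) E) : Matrix (Fin 3) (Fin 3) E) - 1)) *ᵥ y))) ≤ 1} =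
                  valueSetMod σ ϖ (mstarOfRecord d) (xPlus σ ϖ d))}, f' b b Λ : ℕ) : ℤ) -
        ((∑ᶠ Λ ∈ levelSetDep ρ Θ α (jE ϖ) h' b b (lam - jE ((u : Matrix (Fin 1) (Fin 1) E) 0 0)) ∩
          {Λ | ∃ B : Submodule 𝒪[E] (Fin 2 → E), B.toAddSubgroup.map φ' = Λ ∧
            ∃ L₃ : Submodule 𝒪[E] (Fin 3 → E), IsSelfDualLattice σ ϖ (!![(Matrix.diagonal dg) 0 0, 0, (Matrix.diagonal dg) 0 1; 0, η, 0; (Matrix.diagonal dg) 1 0, 0, (Matrix.diagonal dg) 1 1] : Matrix (Fin 3) (Fin 3) E) L₃ ∧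
              L₃ ⊓ LinearMap.ker ((LinearMap.proj (1 : Fin 3) : (Fin 3 → E) →ₗ[E] E).restrictScalars 𝒪[E]) =
                B.map ((Matrix.toLin' (!![1, 0; 0, 0; 0, 1] : Matrix (Fin 3) (Fin 2) E)).restrictScalars 𝒪[E]) ∧
              (∀ c : E, (Pi.single 1 c : Fin 3 → E) ∈ L₃ ↔ Valued.v c ≤ Valued.v ϖ ^ b) ∧
              (LatticeNearTransvShell ϖ (d % 2) (mcOfRecord d) ((((endoGL (γA, u) : GL (Fin 3) E) : Matrix (Fin 3) (Fin 3) E) - 1)) L₃ ∧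
                ¬ {z : E | ∃ y ∈ L₃, Valued.v ((ϖ ^ (mstarOfRecord d))⁻¹ * (z - pairing σ (!![(Matrix.diagonal dg) 0 0, 0, (Matrix.diagonal dg) 0 1; 0, η, 0; (Matrix.diagonal dg) 1 0, 0, (Matrix.diagonal dg) 1 1] : Matrix (Fin 3) (Fin 3) E) y (((((endoGL (γA, u) : GL (Fin 3) E) : Matrix (Fin 3) (Fin 3) E) - 1)) *ᵥ y))) ≤ 1} =
                  valueSetMod σ ϖ (mstarOfRecord d) (xPlus σ ϖ d))}, f' b b Λ : ℕ) : ℤ)) *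
        ((Rd.filter (fun V₀ : E => Valued.v (κ₀ + jE V₀ * ξ₀) * Valued.v (jE ϖ ^ b * (α - ρ α)) = Valued.v (jE ϖ) ^ b ∧
        ∃ e : M, ρ e = e ∧ e * Θ e = (κ₀ + jE V₀ * ξ₀) * ρ (κ₀ + jE V₀ * ξ₀) / (h' * ρ h'))).card : ℤ) =
      ((∑ᶠ Λ ∈ levelSetDep ρ Θ α (jE ϖ) h' b b (lam - jE ((u : Matrix (Fin 1) (Fin 1) E) 0 0)), f' b b Λ : ℕ) : ℤ) *
        (normSign σ (-η) * ∑ V ∈ (Rd.filter (fun V₀ : E => Valued.v (κ₀ + jE V₀ * ξ₀) * Valued.v (jE ϖ ^ b * (α - ρ α)) = Valued.v (jE ϖ) ^ b ∧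
        ∃ e : M, ρ e = e ∧ e * Θ e = (κ₀ + jE V₀ * ξ₀) * ρ (κ₀ + jE V₀ * ξ₀) / (h' * ρ h'))).filter
          (fun V => Valued.v (μa + μb * (R₀ + V * γ₀)) = Valued.v ϖ ^ (2 * b + d % 2)), normSign σ (α₁ + γ₁ * V)))
    -- the DENSITY letters ((β) = ★ `topCell_density (N := 0)`)
    {φd : ℤ}
    (hdensH : ((∑ᶠ Λ ∈ levelSetDep ρ Θ α (jE ϖ) h b b (lam - jE ((u : Matrix (Fin 1) (Fin 1) E) 0 0)), f b b Λ : ℕ) : ℤ) =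
      φd * ((Rd.filter (fun V₀ : E => Valued.v (κ₀ + jE V₀ * ξ₀) * Valued.v (jE ϖ ^ b * (α - ρ α)) = Valued.v (jE ϖ) ^ b ∧
        ∃ e : M, ρ e = e ∧ e * Θ e = (κ₀ + jE V₀ * ξ₀) * ρ (κ₀ + jE V₀ * ξ₀) / (h * ρ h))).card : ℤ))
    (hdensA : ((∑ᶠ Λ ∈ levelSetDep ρ Θ α (jE ϖ) h' b b (lam - jE ((u : Matrix (Fin 1) (Fin 1) E) 0 0)), f' b b Λ : ℕ) : ℤ) =
      φd * ((Rd.filter (fun V₀ : E => Valued.v (κ₀ + jE V₀ * ξ₀) * Valued.v (jE ϖ ^ b * (α - ρ α)) = Valued.v (jE ϖ) ^ b ∧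
        ∃ e : M, ρ e = e ∧ e * Θ e = (κ₀ + jE V₀ * ξ₀) * ρ (κ₀ + jE V₀ * ξ₀) / (h' * ρ h'))).card : ℤ)) :
    (((∑ᶠ Λ ∈ levelSetDep ρ Θ α (jE ϖ) h b b (lam - jE ((u : Matrix (Fin 1) (Fin 1) E) 0 0)) ∩
          {Λ | ∃ B : Submodule 𝒪[E] (Fin 2 → E), B.toAddSubgroup.map φ = Λ ∧
            ∃ L₃ : Submodule 𝒪[E] (Fin 3 → E), IsSelfDualLattice σ ϖ (!![((StdForm.antidiagonal 2).over E) 0 0, 0, ((StdForm.antidiagonal 2).over E) 0 1; 0, (1 : E), 0; ((StdForm.antidiagonal 2).over E) 1 0, 0, ((StdForm.antidiagonal 2).over E) 1 1] : Matrix (Fin 3) (Fin 3) E) L₃ ∧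
              L₃ ⊓ LinearMap.ker ((LinearMap.proj (1 : Fin 3) : (Fin 3 → E) →ₗ[E] E).restrictScalars 𝒪[E]) =
                B.map ((Matrix.toLin' (!![1, 0; 0, 0; 0, 1] : Matrix (Fin 3) (Fin 2) E)).restrictScalars 𝒪[E]) ∧
              (∀ c : E, (Pi.single 1 c : Fin 3 → E) ∈ L₃ ↔ Valued.v c ≤ Valued.v ϖ ^ b) ∧
              (LatticeNearTransvShell ϖ (d % 2) (mstarOfRecord d) ((((endoGL (γ₂, u) : GL (Fin 3) E) : Matrix (Fin 3) (Fin 3) E) - 1)) L₃ ∧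
                {z : E | ∃ y ∈ L₃, Valued.v ((ϖ ^ (mstarOfRecord d))⁻¹ * (z - pairing σ (!![((StdForm.antidiagonal 2).over E) 0 0, 0, ((StdForm.antidiagonal 2).over E) 0 1; 0, (1 : E), 0; ((StdForm.antidiagonal 2).over E) 1 0, 0, ((StdForm.antidiagonal 2).over E) 1 1] : Matrix (Fin 3) (Fin 3) E) y (((((endoGL (γ₂, u) : GL (Fin 3) E) : Matrix (Fin 3) (Fin 3) E) - 1)) *ᵥ y))) ≤ 1} =
                  valueSetMod σ ϖ (mstarOfRecord d) (xPlus σ ϖ d))}, f b b Λ : ℕ) : ℤ) -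
        ((∑ᶠ Λ ∈ levelSetDep ρ Θ α (jE ϖ) h b b (lam - jE ((u : Matrix (Fin 1) (Fin 1) E) 0 0)) ∩
          {Λ | ∃ B : Submodule 𝒪[E] (Fin 2 → E), B.toAddSubgroup.map φ = Λ ∧
            ∃ L₃ : Submodule 𝒪[E] (Fin 3 → E), IsSelfDualLattice σ ϖ (!![((StdForm.antidiagonal 2).over E) 0 0, 0, ((StdForm.antidiagonal 2).over E) 0 1; 0, (1 : E), 0; ((StdForm.antidiagonal 2).over E) 1 0, 0, ((StdForm.antidiagonal 2).over E) 1 1] : Matrix (Fin 3) (Fin 3) E) L₃ ∧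
              L₃ ⊓ LinearMap.ker ((LinearMap.proj (1 : Fin 3) : (Fin 3 → E) →ₗ[E] E).restrictScalars 𝒪[E]) =
                B.map ((Matrix.toLin' (!![1, 0; 0, 0; 0, 1] : Matrix (Fin 3) (Fin 2) E)).restrictScalars 𝒪[E]) ∧
              (∀ c : E, (Pi.single 1 c : Fin 3 → E) ∈ L₃ ↔ Valued.v c ≤ Valued.v ϖ ^ b) ∧
              (LatticeNearTransvShell ϖ (d % 2) (mcOfRecord d) ((((endoGL (γ₂, u) : GL (Fin 3) E) : Matrix (Fin 3) (Fin 3) E) - 1)) L₃ ∧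
                ¬ {z : E | ∃ y ∈ L₃, Valued.v ((ϖ ^ (mstarOfRecord d))⁻¹ * (z - pairing σ (!![((StdForm.antidiagonal 2).over E) 0 0, 0, ((StdForm.antidiagonal 2).over E) 0 1; 0, (1 : E), 0; ((StdForm.antidiagonal 2).over E) 1 0, 0, ((StdForm.antidiagonal 2).over E) 1 1] : Matrix (Fin 3) (Fin 3) E) y (((((endoGL (γ₂, u) : GL (Fin 3) E) : Matrix (Fin 3) (Fin 3) E) - 1)) *ᵥ y))) ≤ 1} =
                  valueSetMod σ ϖ (mstarOfRecord d) (xPlus σ ϖ d))}, f b b Λ : ℕ) : ℤ)) =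
      if 0 < d then
        (((∑ᶠ Λ ∈ levelSetDep ρ Θ α (jE ϖ) h' b b (lam - jE ((u : Matrix (Fin 1) (Fin 1) E) 0 0)) ∩
          {Λ | ∃ B : Submodule 𝒪[E] (Fin 2 → E), B.toAddSubgroup.map φ' = Λ ∧
            ∃ L₃ : Submodule 𝒪[E] (Fin 3 → E), IsSelfDualLattice σ ϖ (!![(Matrix.diagonal dg) 0 0, 0, (Matrix.diagonal dg) 0 1; 0, η, 0; (Matrix.diagonal dg) 1 0, 0, (Matrix.diagonal dg) 1 1] : Matrix (Fin 3) (Fin 3) E) L₃ ∧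
              L₃ ⊓ LinearMap.ker ((LinearMap.proj (1 : Fin 3) : (Fin 3 → E) →ₗ[E] E).restrictScalars 𝒪[E]) =
                B.map ((Matrix.toLin' (!![1, 0; 0, 0; 0, 1] : Matrix (Fin 3) (Fin 2) E)).restrictScalars 𝒪[E]) ∧
              (∀ c : E, (Pi.single 1 c : Fin 3 → E) ∈ L₃ ↔ Valued.v c ≤ Valued.v ϖ ^ b) ∧
              (LatticeNearTransvShell ϖ (d % 2) (mstarOfRecord d) ((((endoGL (γA, u) : GL (Fin 3) E) : Matrix (Fin 3) (Fin 3) E) - 1)) L₃ ∧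
                {z : E | ∃ y ∈ L₃, Valued.v ((ϖ ^ (mstarOfRecord d))⁻¹ * (z - pairing σ (!![(Matrix.diagonal dg) 0 0, 0, (Matrix.diagonal dg) 0 1; 0, η, 0; (Matrix.diagonal dg) 1 0, 0, (Matrix.diagonal dg) 1 1] : Matrix (Fin 3) (Fin 3) E) y (((((endoGL (γA, u) : GL (Fin 3) E) : Matrix (Fin 3) (Fin 3) E) - 1)) *ᵥ y))) ≤ 1} =
                  valueSetMod σ ϖ (mstarOfRecord d) (xPlus σ ϖ d))}, f' b b Λ : ℕ) : ℤ) -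
        ((∑ᶠ Λ ∈ levelSetDep ρ Θ α (jE ϖ) h' b b (lam - jE ((u : Matrix (Fin 1) (Fin 1) E) 0 0)) ∩
          {Λ | ∃ B : Submodule 𝒪[E] (Fin 2 → E), B.toAddSubgroup.map φ' = Λ ∧
            ∃ L₃ : Submodule 𝒪[E] (Fin 3 → E), IsSelfDualLattice σ ϖ (!![(Matrix.diagonal dg) 0 0, 0, (Matrix.diagonal dg) 0 1; 0, η, 0; (Matrix.diagonal dg) 1 0, 0, (Matrix.diagonal dg) 1 1] : Matrix (Fin 3) (Fin 3) E) L₃ ∧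
              L₃ ⊓ LinearMap.ker ((LinearMap.proj (1 : Fin 3) : (Fin 3 → E) →ₗ[E] E).restrictScalars 𝒪[E]) =
                B.map ((Matrix.toLin' (!![1, 0; 0, 0; 0, 1] : Matrix (Fin 3) (Fin 2) E)).restrictScalars 𝒪[E]) ∧
              (∀ c : E, (Pi.single 1 c : Fin 3 → E) ∈ L₃ ↔ Valued.v c ≤ Valued.v ϖ ^ b) ∧
              (LatticeNearTransvShell ϖ (d % 2) (mcOfRecord d) ((((endoGL (γA, u) : GL (Fin 3) E) : Matrix (Fin 3) (Fin 3) E) - 1)) L₃ ∧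
                ¬ {z : E | ∃ y ∈ L₃, Valued.v ((ϖ ^ (mstarOfRecord d))⁻¹ * (z - pairing σ (!![(Matrix.diagonal dg) 0 0, 0, (Matrix.diagonal dg) 0 1; 0, η, 0; (Matrix.diagonal dg) 1 0, 0, (Matrix.diagonal dg) 1 1] : Matrix (Fin 3) (Fin 3) E) y (((((endoGL (γA, u) : GL (Fin 3) E) : Matrix (Fin 3) (Fin 3) E) - 1)) *ᵥ y))) ≤ 1} =
                  valueSetMod σ ϖ (mstarOfRecord d) (xPlus σ ϖ d))}, f' b b Λ : ℕ) : ℤ))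
      else 0 := by
  classical
  obtain ⟨-, -, hϖ, -, -, hd1, -⟩ := id hD
  have hρj : ∀ c : E, ρ (jE c) = jE c := fun c => (hjfix _).2 ⟨c, rfl⟩
  have h2v : Valued.v (2 : E) < 1 := by exact_mod_cast Valuation.Integer.not_isUnit_iff_valuation_lt_one.mp h2
  rw [if_pos (by omega : 0 < d)]
  -- the solved values of the two gap-zero cells (★ §3 with the density letters)
  have hXH := cellValue_of_perCellLaw ρ Θ α (jE ϖ) h (lam - jE ((u : Matrix (Fin 1) (Fin 1) E) 0 0)) f b b _ _ (hfinLS b b) _ _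
    (Finset.filter_subset _ _) (fun V => normSign σ (α₁ + γ₁ * V)) (normSign σ (-(1 : E))) φd hlawH hdensH
  have hXA := cellValue_of_perCellLaw ρ Θ α (jE ϖ) h' (lam - jE ((u : Matrix (Fin 1) (Fin 1) E) 0 0)) f' b b _ _ (hfinLS' b b) _ _
    (Finset.filter_subset _ _) (fun V => normSign σ (α₁ + γ₁ * V)) (normSign σ (-η)) φd hlawA hdensA
  -- the sign letter `ω(−η) = −ω(−1)`
  have hsgn : normSign σ (-η) = -normSign σ (-(1 : E)) := by
    have h1 := normSign_mul_eq_neg_of_not_norm hD hησ hηN (g := -(1 : E)) (by rw [map_neg, map_one]) (neg_ne_zero.2 one_ne_zero)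
    rwa [mul_neg_one] at h1
  -- the digit line: at radius one the sphere clause is automatic; `NX ↔ unit label`
  have hR1 : Valued.v (jE ϖ ^ b * (α - ρ α)) = Valued.v (jE ϖ) ^ b := by rw [Valuation.map_mul, hU, mul_one, Valuation.map_pow]
  have hsph : ∀ V ∈ Rd, Valued.v (κ₀ + jE V * ξ₀) * Valued.v (jE ϖ ^ b * (α - ρ α)) = Valued.v (jE ϖ) ^ b :=
    fun V hV => sphereClause_of_radius_one hvρ jE hρj hjiso hR1 hκ₀ hκ₀v hξ hξ1.le (hRd1 V hV).2
  have hNX : ∀ V ∈ Rd, (Valued.v (μa + μb * (R₀ + V * γ₀)) = Valued.v ϖ ^ (2 * b + d % 2) ↔ Valued.v (α₁ + γ₁ * V) = 1) :=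
    fun V hV => ⟨hαγ V (hRd1 V hV).1 (hRd1 V hV).2, hγα V (hRd1 V hV).1 (hRd1 V hV).2⟩
  -- ★ p864688 §1: the unit-label digits' signs sum to zero
  have hsum0 := sum_normSign_affine_filterUnit_eq_zero hD h2v hα₁σ hα₁1 hγ₁σ hγ₁v hn Rd hRd1 hRd2 hRd3
  -- the class split of the unit-label digits: `S′_H ⊔ S′_A`
  have hunion : ((Rd.filter (fun V₀ : E => Valued.v (κ₀ + jE V₀ * ξ₀) * Valued.v (jE ϖ ^ b * (α - ρ α)) = Valued.v (jE ϖ) ^ b ∧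
        ∃ e : M, ρ e = e ∧ e * Θ e = (κ₀ + jE V₀ * ξ₀) * ρ (κ₀ + jE V₀ * ξ₀) / (h * ρ h))).filter
        (fun V => Valued.v (μa + μb * (R₀ + V * γ₀)) = Valued.v ϖ ^ (2 * b + d % 2))) ∪
      ((Rd.filter (fun V₀ : E => Valued.v (κ₀ + jE V₀ * ξ₀) * Valued.v (jE ϖ ^ b * (α - ρ α)) = Valued.v (jE ϖ) ^ b ∧
        ∃ e : M, ρ e = e ∧ e * Θ e = (κ₀ + jE V₀ * ξ₀) * ρ (κ₀ + jE V₀ * ξ₀) / (h' * ρ h'))).filter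
        (fun V => Valued.v (μa + μb * (R₀ + V * γ₀)) = Valued.v ϖ ^ (2 * b + d % 2))) =
      Rd.filter (fun V => Valued.v (α₁ + γ₁ * V) = 1) := by
    ext V
    simp only [Finset.mem_union, Finset.mem_filter]
    constructor
    · rintro (⟨⟨hV, -, -⟩, hX⟩ | ⟨⟨hV, -, -⟩, hX⟩)
      · exact ⟨hV, (hNX V hV).1 hX⟩
      · exact ⟨hV, (hNX V hV).1 hX⟩
    · rintro ⟨hV, hU1⟩
      have hX := (hNX V hV).2 hU1
      rcases classClause_or hD jE hjfix hΘj hρρ hΘρ P₁ dg η hA hηN φ hform hΘh hh φ' hform' hΘh' hh' hκ₀ hΘκ₀ hξ hΘξ (hRd1 V hV).1 with hcl | hcl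
      · exact Or.inl ⟨⟨hV, hsph V hV, hcl⟩, hX⟩
      · exact Or.inr ⟨⟨hV, hsph V hV, hcl⟩, hX⟩
  have hdisj : Disjoint
      ((Rd.filter (fun V₀ : E => Valued.v (κ₀ + jE V₀ * ξ₀) * Valued.v (jE ϖ ^ b * (α - ρ α)) = Valued.v (jE ϖ) ^ b ∧
        ∃ e : M, ρ e = e ∧ e * Θ e = (κ₀ + jE V₀ * ξ₀) * ρ (κ₀ + jE V₀ * ξ₀) / (h * ρ h))).filter
        (fun V => Valued.v (μa + μb * (R₀ + V * γ₀)) = Valued.v ϖ ^ (2 * b + d % 2)))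
      ((Rd.filter (fun V₀ : E => Valued.v (κ₀ + jE V₀ * ξ₀) * Valued.v (jE ϖ ^ b * (α - ρ α)) = Valued.v (jE ϖ) ^ b ∧
        ∃ e : M, ρ e = e ∧ e * Θ e = (κ₀ + jE V₀ * ξ₀) * ρ (κ₀ + jE V₀ * ξ₀) / (h' * ρ h'))).filter
        (fun V => Valued.v (μa + μb * (R₀ + V * γ₀)) = Valued.v ϖ ^ (2 * b + d % 2))) := by
    rw [Finset.disjoint_left]
    intro V hVH hVA
    simp only [Finset.mem_filter] at hVH hVA
    exact (classClause_iff_not_classClause hD jE hjfix hΘj hρρ hΘρ P₁ dg η hA hηN φ hform hΘh hh φ' hform' hΘh' hh' hκ₀ hΘκ₀ hξ hΘξ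
      (hRd1 V hVH.1.1).1).1 hVA.1.2.2 hVH.1.2.2
  have hsum := Finset.sum_union hdisj (f := fun V => normSign σ (α₁ + γ₁ * V))
  rw [hunion, hsum0] at hsum
  rw [hXH, hXA, hsgn]
  linear_combination (-(φd * normSign σ (-(1 : E)))) * hsum

end Summit.HodgeConjecture.HodgeConjecture.Cruxes.H413.F0P3cDyRamDiagCellGapZeroIdentity

end
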